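import Summits.QuantumFields.YangMills.Theorems.UnitScaleTiltProp7CoerciveOfNormG0Comb
import HarnessLib

/-!
# Route `UnitScaleTilt`, crux K1 «MinimiserStabilityRegPr» (stmt-QuantumFields-19200) — ARCHITECTURE (A′) ON Σ: **THE N06 SOCKET ADAPTER** — the displayed row `hN06` of the junction of
# record (S27ᴸ ✓p698452 ∕ ✓p697014 `hcoS_of_normG0_of_combRemainderL1Rows`: «∃ right inverse `G₀` of the comb `Δ_a(W)` with `‖G₀ f‖ ≤ B₀‖f‖`») FROM PRINT's LITERAL FORM OF
# [Balaban1985BackgroundPropagators] THEOREM 3.11 «`Δ_a` is positive definite», read quantitatively as COERCIVITY `γ‖y‖² ≤ re⟪y, Δ_a(W) y⟫` with an L-only `γ` (`B₀ := γ⁻¹`)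

Cell `ym3-torus` ∕ fleet seat `ym-ust-19200-p1` (gen 18, route-R E′ growth-side lead ∕ namer).  THEOREMS ONLY (0 `def`, 0 `sorry`); `--supports stmt-QuantumFields-19200`, count-neutral.
YM₃ on T³ is a ladder rung (R3), not the Clay problem; nothing here claims the stub, the crux, N06, d = 4 or the mass gap — the coercivity row is a HYPOTHESIS (A6ᶜ ∕ R-CORE, OPEN).

WHY.  The R-CORE lane's natural output is a COERCIVITY statement (the COMB-FLAT lane already has this shape at `W = 1`: ★px6 ✓`coercive_laplaceAc_one_of_sliceBound`, ★px13
`coercive_laplaceAc_one_of_sliceBound_basePt`; print's Thm 3.11 p.416 is «positive definite», its proof gives a uniform lower bound), while the EX display of record carries N06 in the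
`norm_G₀ᶜ` form (so that ★w4 ✓`coercive_slots_DeltaEta_of_normG₀` can ALSO serve the `hPosΔ`-type rows).  This adapter closes the gap once and for all: in finite dimension a coercive
endomorphism of a complex inner-product space is injective, hence bijective (`LinearEquiv.ofInjectiveEndo`), and its inverse `G₀` satisfies `‖G₀ f‖ ≤ γ⁻¹‖f‖`
(`γ‖G₀f‖² ≤ re⟪G₀f, f⟫ ≤ ‖G₀f‖·‖f‖`).  No almost-positivity, no window: the coercive form is STRONGER than `norm_G₀ᶜ` and implies it verbatim.

WHAT IS PROVED (ns `…Theorems.Prop7NormG0OfCoercive`): ★ `exists_rightInverse_of_coercive` (generic: `γ > 0`, `∀ y, γ‖y‖² ≤ re⟪y, A y⟫` ⊢ `∃ G₀, A ∘ₗ G₀ = id ∧ ∀ f, ‖G₀ f‖ ≤ γ⁻¹‖f‖`);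
★★★ `hN06_of_coerciveRow` — the member-level COERCIVITY row at the comb slots of record (per `L` an L-only `γ > 0` and radius `eN`, then `∀ F hF n K hnK e W`, `RegPr F n K e W`,
`∀ y, γ‖y‖² ≤ re⟪y, Δ_aᶜ(W) y⟫`) ⊢ the `hN06` hypothesis of ✓`hcoS_of_normG0_of_combRemainderL1Rows` ∕ S27ᴸ TOKEN FOR TOKEN (`B₀ := γ⁻¹`).
HONEST SCOPE.  Finite-dimensional linear algebra; the coercivity row is displayed; nothing of print asserted; rung R3, not Clay; YM gap NOT proved.

References: T. Bałaban, CMP 99 (1985) 389–434 [Balaban1985BackgroundPropagators] (Thm 3.11 p.416, Thm 3.3 p.399, (3.26)–(3.27) p.395); CMP 102 (1985) 277–309 [Balaban1985Variational] ((141)–(142) p.299).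
-/

set_option autoImplicit false
noncomputable section

open scoped BigOperators Matrix.Norms.L2Operator Matrix Topology InnerProductSpace
open Filter NormedSpace

namespace Summit.QuantumFields.YangMills.Theorems.Prop7NormG0OfCoercive

open Literature.MathematicalPhysics.QuantumFieldTheory.Balaban1983to89
open Literature.MathematicalPhysics.QuantumFieldTheory.Balaban1983to89.T3ContinuumYM3Torus
open Literature.MathematicalPhysics.QuantumFieldTheory.Balaban1983to89.T3PrintedRegularMinimiser (RegPr)
open B11Eq103H1Complex (BondL2K laplaceAK)
open Summit.QuantumFields.YangMills.Theorems.Prop7SectET3Transport (periodsT3)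
open Summit.QuantumFields.YangMills.Theorems.Prop7SectET3HilbertLetters (W₂ toL2 DL2 DstarL2)
open Summit.QuantumFields.YangMills.Theorems.Prop7SectET3WilsonHessian (DeltaEtaSlot)
open Summit.QuantumFields.YangMills.Theorems.Prop7SectET3CombLetters (Qkc)
open Summit.QuantumFields.YangMills.Theorems.Prop7QprimeCombL2 (RcombL2)

/-! ## §1 Generic: a coercive endomorphism of a finite-dimensional complex inner-product space has a bounded right inverse -/

/-- ★ **COERCIVE ⟹ BOUNDED RIGHT INVERSE** (finite dimension): `γ > 0`, `∀ y, γ‖y‖² ≤ re⟪y, A y⟫` ⊢ `∃ G₀, A ∘ₗ G₀ = id ∧ ∀ f, ‖G₀ f‖ ≤ γ⁻¹‖f‖`.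
[finite-dimensional linear algebra; cite: Balaban1985BackgroundPropagators, Thm 3.11 p.416, (3.27) p.395] -/
theorem exists_rightInverse_of_coercive {E : Type*} [NormedAddCommGroup E] [InnerProductSpace ℂ E] [FiniteDimensional ℂ E]
    (A : E →ₗ[ℂ] E) {γ : ℝ} (hγ : 0 < γ) (hco : ∀ y : E, γ * ‖y‖ ^ 2 ≤ RCLike.re ⟪y, A y⟫_ℂ) :
    ∃ G₀ : E →ₗ[ℂ] E, A ∘ₗ G₀ = LinearMap.id ∧ ∀ f : E, ‖G₀ f‖ ≤ γ⁻¹ * ‖f‖ := by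
  -- injectivity from coercivity
  have hinj : Function.Injective A := by
    rw [← LinearMap.ker_eq_bot, LinearMap.ker_eq_bot']
    intro y hy
    have h := hco y
    rw [hy, inner_zero_right, map_zero] at h
    have h0 : ‖y‖ ^ 2 ≤ 0 := by
      by_contra hne
      have := mul_pos hγ (not_le.mp hne)
      linarith
    have : ‖y‖ = 0 := by nlinarith [norm_nonneg y]
    exact norm_eq_zero.mp this
  refine ⟨((LinearEquiv.ofInjectiveEndo A hinj).symm : E →ₗ[ℂ] E), ?_, ?_⟩
  · exact LinearEquiv.ofInjectiveEndo_right_inv A hinj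
  · intro f
    set g : E := (LinearEquiv.ofInjectiveEndo A hinj).symm f with hg
    have hAg : A g = f := by
      rw [hg, ← LinearEquiv.coe_ofInjectiveEndo A hinj]
      exact (LinearEquiv.ofInjectiveEndo A hinj).apply_symm_apply f
    have h1 : γ * ‖g‖ ^ 2 ≤ ‖g‖ * ‖f‖ := by
      calc γ * ‖g‖ ^ 2 ≤ RCLike.re ⟪g, A g⟫_ℂ := hco g
        _ ≤ ‖⟪g, A g⟫_ℂ‖ := RCLike.re_le_norm _
        _ ≤ ‖g‖ * ‖A g‖ := norm_inner_le_norm g (A g)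
        _ = ‖g‖ * ‖f‖ := by rw [hAg]
    show ‖g‖ ≤ γ⁻¹ * ‖f‖
    have hγg : γ * ‖g‖ ≤ ‖f‖ := by
      by_cases hg0 : ‖g‖ = 0
      · rw [hg0, mul_zero]; exact norm_nonneg f
      · have hgpos : 0 < ‖g‖ := lt_of_le_of_ne (norm_nonneg g) (Ne.symm hg0)
        have h2 : γ * ‖g‖ * ‖g‖ ≤ ‖f‖ * ‖g‖ := by nlinarith [h1]
        exact le_of_mul_le_mul_right h2 hgpos
    calc ‖g‖ = γ⁻¹ * (γ * ‖g‖) := by field_simp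
      _ ≤ γ⁻¹ * ‖f‖ := mul_le_mul_of_nonneg_left hγg (inv_pos.mpr hγ).le

/-! ## §2 The N06 socket adapter at the comb slots of record -/

section Adapter

variable (c₀ cB a₀ : ℕ → ℝ) [hc₀ : ∀ L : ℕ, Fact (0 < c₀ L)] [hcB : ∀ L : ℕ, Fact (0 < cB L)]

/-- ★★★ **N06 SOCKET ADAPTER — COERCIVITY ROW ⟹ `norm_G₀ᶜ` ROW.**  The member-level coercivity of the comb `Δ_aᶜ(W) = laplaceAK (Δ^η W) D_W (RcombL2 W) D*_W (Qkc W) (Qkc W)† aQ`,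
`aQ := a₀(c₀∕cB)ℓ³` — per `L` an L-only `γ > 0` and radius `eN > 0`, at every `W ∈ RegPr F n K e`, `e ≤ eN`: `∀ y, γ‖y‖² ≤ re⟪y, Δ_aᶜ(W) y⟫` ([Balaban1985BackgroundPropagators] Thm 3.11,
quantitative; DISPLAYED) — gives the `hN06` hypothesis of ✓`Prop7CmapTwSupRow.hcoS_of_normG0_of_combRemainderL1Rows` ∕ of S27ᴸ ✓p698452 TOKEN FOR TOKEN, with `B₀ := γ⁻¹`.
[cite: Balaban1985BackgroundPropagators, Thm 3.11 p.416, Thm 3.3 p.399, (3.26)-(3.27) p.395; Balaban1985Variational, (141)-(142) p.299] -/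
theorem hN06_of_coerciveRow
    (hCo : ∀ (L : ℕ), 1 < L → ∃ γ eN : ℝ, 0 < γ ∧ 0 < eN ∧
      ∀ (F : T3Family), F.L = L → ∀ (n K : ℕ) (hnK : n < K) (e : ℝ) (W : GaugeField (F.P K) 0 (Matrix.specialUnitaryGroup (Fin 2) ℂ)),
        0 < e → e ≤ eN → RegPr F n K e W →
        ∀ y : BondL2K ℂ 3 (periodsT3 F K) (c₀ F.L) W₂,
          γ * ‖y‖ ^ 2 ≤ RCLike.re ⟪y, laplaceAK (DeltaEtaSlot F n K (c₀ F.L) W) (DL2 F n K (c₀ F.L) W) (RcombL2 F n K (c₀ F.L) W) (DstarL2 F n K (c₀ F.L) W)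
              (Qkc F n K hnK.le (c₀ F.L) (cB F.L) W) (LinearMap.adjoint (Qkc F n K hnK.le (c₀ F.L) (cB F.L) W))
              (((a₀ F.L * (c₀ F.L / cB F.L) * ((F.L : ℝ) ^ (K - n)) ^ 3 : ℝ) : ℂ)) y⟫_ℂ) :
    ∀ (L : ℕ), 1 < L → ∃ B₀ eN : ℝ, 0 < B₀ ∧ 0 < eN ∧
      ∀ (F : T3Family), F.L = L → ∀ (n K : ℕ) (hnK : n < K) (e : ℝ) (W : GaugeField (F.P K) 0 (Matrix.specialUnitaryGroup (Fin 2) ℂ)),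
        0 < e → e ≤ eN → RegPr F n K e W →
        ∃ G₀ : BondL2K ℂ 3 (periodsT3 F K) (c₀ F.L) W₂ →ₗ[ℂ] BondL2K ℂ 3 (periodsT3 F K) (c₀ F.L) W₂,
          laplaceAK (DeltaEtaSlot F n K (c₀ F.L) W) (DL2 F n K (c₀ F.L) W) (RcombL2 F n K (c₀ F.L) W) (DstarL2 F n K (c₀ F.L) W)
              (Qkc F n K hnK.le (c₀ F.L) (cB F.L) W) (LinearMap.adjoint (Qkc F n K hnK.le (c₀ F.L) (cB F.L) W))
              (((a₀ F.L * (c₀ F.L / cB F.L) * ((F.L : ℝ) ^ (K - n)) ^ 3 : ℝ) : ℂ)) ∘ₗ G₀ = LinearMap.id ∧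
          ∀ f, ‖G₀ f‖ ≤ B₀ * ‖f‖ := by
  intro L hL
  obtain ⟨γ, eN, hγ, heN, H⟩ := hCo L hL
  refine ⟨γ⁻¹, eN, inv_pos.mpr hγ, heN, ?_⟩
  intro F hF n K hnK e W he heN' hreg
  exact exists_rightInverse_of_coercive _ hγ (H F hF n K hnK e W he heN' hreg)

end Adapter

end Summit.QuantumFields.YangMills.Theorems.Prop7NormG0OfCoercive

end
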